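import Literature.IUT.HodgeArakelov.CommutatorPairingIdentities
import Literature.AnabelianGeometry.EtaleTheta.Discharge.Sec2DtpYThetaAbelian
import Literature.AnabelianGeometry.EtaleTheta.Discharge.Sec1DeltaThetaTateTwist
import HarnessLib

/-!
# [IUTchII] Rmk. 1.1.1 (iii)/(iv): the commutator pairing `θ[x, b]` on `Δ^tp_X × Δ^tp_Y` depends only on
# `(x mod Δ^tp_Y, b mod Ker(Δ^tp_Y ↠ (Δ^tp_Y)^ell))` — WELL-DEFINEDNESS OFF `Π^tp_X̲̲` (helper toward GAP G-w4d018-1)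

Mochizuki, *Inter-universal Teichmüller theory II*, §1, Remark 1.1.1 (iii), kurims manuscript (Dec. 2020) pp. 22–23:
«by considering liftings of automorphisms of `Δ_Y(M)` determined by conjugation by elements of `Δ_X(M)` … and then
forming the commutator `γ(β)·β⁻¹` of such liftings with arbitrary `β ∈ Δ_Y(M)`, one obtains a natural bilinear
commutator map `[-,-] : (Δ_X(M)/Δ_Y(M)) × Δ^ell_Y(M) → Π_M|_{(l·Δ_Θ)(M)}`» and (iv) p. 23 «this commutator map is
equivariant with respect to these natural actions by `Π_C(M)`» [claim: Mochizuki2012, status: disputed] (IUTchII §1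
Rmk 1.1.1 (iii), kurims pp.22-23); [EtTh] §1 p. 12 «`Δ^Θ_X := Δ_X/[Δ_X,[Δ_X,Δ_X]]` … a central extension»
[cite: MochizukiEtTh2009, §1 p.12].

Cell abc-iut, seat abc-iut-w4-d018 (gen 6), helper toward the residual **G-w4d018-1** of row «G-w4d043-2
FLSYMMETRY-GENUINE» (commutator equivariance under the conjugation action of `Π^tp_C`). PROOF-ONLY (0 `def`).
abc-iut-w5-d225's `exists_twoSections_of_coreTower` (p437698) proves the independence of the commutator class
`θ(x b x⁻¹ b⁻¹)` of the chosen lifts INSIDE `Π^tp_X̲̲` (lifts `x ∈ Δ_X̲̲ = Δ^tp_X ∩ Π^tp_X̲̲`, `b ∈ Δ_Y̲̲`). Since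
`Π^tp_X̲̲` is not normal in `Π^tp_C` (abc-iut-L2-d1 `SettingModel.not_normal_Huuχ`), the equivariance under `Π^tp_C`
needs the same independence for ARBITRARY lifts `x ∈ Δ^tp_X`, `b ∈ Δ^tp_Y` — which this file proves, over the
§1 interface and `IsEtThOrigin` (abc-iut-L2-t8's THEOREM `dtpYTheta_comm`: `(Δ^tp_Y)^Θ` is abelian):

* `ThetaSetting.toTheta_commutator_eq_of_toZ_eq` — for `x, x' ∈ Δ^tp_X` with `toZ x = toZ x'` and `b ∈ Δ^tp_Y`:
  `θ(x b x⁻¹ b⁻¹) = θ(x' b x'⁻¹ b'⁻¹)`… i.e. the pairing factors through `Δ^tp_X/Δ^tp_Y = Z` in the first variable;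
* `ThetaSetting.toTheta_commutator_eq_of_toEll_eq` — for `x ∈ Δ^tp_X` and `b, b' ∈ Δ^tp_Y` with the same image in
  `(Π^tp_X)^ell`: `θ(x b x⁻¹ b⁻¹) = θ(x b' x⁻¹ b'⁻¹)` (the pairing factors through `(Δ^tp_Y)^ell` in the second);
* `ThetaSetting.toTheta_commutator_eq_of_toZ_eq_of_toEll_eq` — both at once.

Inputs BY NAME: `IsEtThOrigin` (for `dtpYTheta_comm`), the root fields `ker_thetaToEll_central` / `_comm`, and
abc-iut-w5-d225's group identities `conjComm_central_mul_left` / `conjComm_mul_central_right`. HONEST FRAMING: kernel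
facts about the cell's typed §1 interface; nothing of [IUTchII] asserted; outside the [IUTchIII] Cor. 3.12 cone; no
side taken; typed ≠ proved.
-/

noncomputable section

namespace Literature.IUT.HodgeArakelov

open Literature.AnabelianGeometry.EtaleTheta Literature.AnabelianGeometry.SemiGraphs

namespace ThetaSettingPairing

variable {p : ℕ} [Fact p.Prime] (D : ThetaSetting p)

/-- **First variable: the pairing factors through `Δ^tp_X/Δ^tp_Y = Z`.** For `x, x' ∈ Δ^tp_X` with the same
image in `Z` and `b ∈ Δ^tp_Y`, `θ(x b x⁻¹ b⁻¹) = θ(x' b x'⁻¹ b⁻¹)`: `x' = x δ` with `δ ∈ Δ^tp_Y`, and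
`θ(δ)`, `θ(b)` commute in the ABELIAN `(Δ^tp_Y)^Θ` (`dtpYTheta_comm`).
[claim: Mochizuki2012, status: disputed] (IUTchII §1 Rmk 1.1.1 (iii), kurims p.23) -/
theorem toTheta_commutator_eq_of_toZ_eq (hO : D.IsEtThOrigin) {x x' b : D.PiTemp}
    (hx : x ∈ D.DeltaTemp) (hx' : x' ∈ D.DeltaTemp) (hxx' : D.toZ x = D.toZ x')
    (hb : b ∈ D.DtpY) :
    D.toTheta (x * b * x⁻¹ * b⁻¹) = D.toTheta (x' * b * x'⁻¹ * b⁻¹) := by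
  -- `x' = x δ` with `δ ∈ Δ^tp_Y`
  obtain ⟨δ, rfl⟩ : ∃ δ, x' = x * δ := ⟨x⁻¹ * x', by group⟩
  have hδΔ : δ ∈ D.DeltaTemp := by
    have h := mul_mem (inv_mem hx) hx'
    rwa [inv_mul_cancel_left] at h
  have hδY : δ ∈ D.GtpY := by
    change D.toZ δ = 1
    rw [map_mul] at hxx'
    exact (mul_eq_left.mp hxx'.symm)
  have hδ : D.toTheta δ ∈ D.DtpYTheta := Subgroup.mem_map_of_mem _ ⟨hδY, hδΔ⟩
  have hbΘ : D.toTheta b ∈ D.DtpYTheta := Subgroup.mem_map_of_mem _ hb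
  simp only [map_mul, map_inv]
  exact (conjComm_central_mul_left _ _ _ (D.dtpYTheta_comm hO _ hδ _ hbΘ)).symm

/-- **Second variable: the pairing factors through `(Δ^tp_Y)^ell`.** For `x ∈ Δ^tp_X` and `b, b' ∈ Δ^tp_Y` with
the same image in `(Π^tp_X)^ell`, `θ(x b x⁻¹ b⁻¹) = θ(x b' x⁻¹ b'⁻¹)`: `b' = b c` with `θ(c) ∈ Δ_Θ`, which is
CENTRAL in `(Δ^tp_X)^Θ` (root field `ker_thetaToEll_central`).
[claim: Mochizuki2012, status: disputed] (IUTchII §1 Rmk 1.1.1 (iii), kurims p.23) -/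
theorem toTheta_commutator_eq_of_toEll_eq {x b b' : D.PiTemp} (hx : x ∈ D.DeltaTemp)
    (hbb' : D.thetaToEll (D.toTheta b) = D.thetaToEll (D.toTheta b')) :
    D.toTheta (x * b * x⁻¹ * b⁻¹) = D.toTheta (x * b' * x⁻¹ * b'⁻¹) := by
  -- `b' = b c` with `θ(c) ∈ Δ_Θ`
  obtain ⟨c, rfl⟩ : ∃ c, b' = b * c := ⟨b⁻¹ * b', by group⟩
  have hc : D.toTheta c ∈ D.DeltaTheta := by
    change D.thetaToEll _ = 1
    rw [map_mul, map_mul] at hbb'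
    exact mul_eq_left.mp hbb'.symm
  have hxinv : (D.toTheta x)⁻¹ ∈ (D.aug.toMonoidHom.ker).map D.toTheta := by
    rw [← map_inv]; exact Subgroup.mem_map_of_mem _ (inv_mem hx)
  simp only [map_mul, map_inv]
  exact (conjComm_mul_central_right _ _ _ (D.ker_thetaToEll_central _ hc _ hxinv)).symm

/-- **Both variables**: the commutator pairing `Δ^tp_X × Δ^tp_Y → Δ_Θ ⊆ (Π^tp_X)^Θ`, `(x, b) ↦ θ(x b x⁻¹ b⁻¹)`, only
depends on `(toZ x, the image of b in (Π^tp_X)^ell)` — the bilinear map `(Δ_X/Δ_Y) × Δ^ell_Y → …` of Rmk. 1.1.1 (iii)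
is well defined on ARBITRARY lifts in `Δ^tp_X`, `Δ^tp_Y` (not only lifts inside `Π^tp_X̲̲`).
[claim: Mochizuki2012, status: disputed] (IUTchII §1 Rmk 1.1.1 (iii), kurims p.23) -/
theorem toTheta_commutator_eq_of_toZ_eq_of_toEll_eq (hO : D.IsEtThOrigin) {x x' b b' : D.PiTemp}
    (hx : x ∈ D.DeltaTemp) (hx' : x' ∈ D.DeltaTemp) (hxx' : D.toZ x = D.toZ x')
    (hb : b ∈ D.DtpY) (hbb' : D.thetaToEll (D.toTheta b) = D.thetaToEll (D.toTheta b')) :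
    D.toTheta (x * b * x⁻¹ * b⁻¹) = D.toTheta (x' * b' * x'⁻¹ * b'⁻¹) := by
  rw [toTheta_commutator_eq_of_toZ_eq D hO hx hx' hxx' hb]
  exact toTheta_commutator_eq_of_toEll_eq D hx' hbb'

/-- **Equivariance of the pairing under any `Δ^tp_X`-stabilising automorphism read on the two factors**: if `Γ`
is a group endomorphism of `Π^tp_X` (e.g. abc-iut-L2-d3's restricted inner automorphism `conjX c` of `Π^tp_C`), then
`θ(Γ[x, b]) = θ([x'', b''])` for ANY `x'' ∈ Δ^tp_X`, `b''` with `toZ x'' = toZ (Γ x)` and `b''` over `Γ b` in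
`(Π^tp_X)^ell` — the form in which the conjugation action on `(Δ_X/Δ_Y) × Δ^ell_Y` meets the commutator map.
[claim: Mochizuki2012, status: disputed] (IUTchII §1 Rmk 1.1.1 (iv), kurims p.23) -/
theorem toTheta_map_commutator_eq (hO : D.IsEtThOrigin) (Γ : D.PiTemp →* D.PiTemp) {x b x'' b'' : D.PiTemp}
    (hΓx : Γ x ∈ D.DeltaTemp) (hx'' : x'' ∈ D.DeltaTemp) (hxx : D.toZ (Γ x) = D.toZ x'')
    (hΓb : Γ b ∈ D.DtpY) (hbb : D.thetaToEll (D.toTheta (Γ b)) = D.thetaToEll (D.toTheta b'')) :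
    D.toTheta (Γ (x * b * x⁻¹ * b⁻¹)) = D.toTheta (x'' * b'' * x''⁻¹ * b''⁻¹) := by
  have hΓ : Γ (x * b * x⁻¹ * b⁻¹) = Γ x * Γ b * (Γ x)⁻¹ * (Γ b)⁻¹ := by simp only [map_mul, map_inv]
  rw [hΓ]
  exact toTheta_commutator_eq_of_toZ_eq_of_toEll_eq D hO hΓx hx'' hxx hΓb hbb

end ThetaSettingPairing

end Literature.IUT.HodgeArakelov

end
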